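import Summits.QuantumFields.QCD.Theorems.PauliWegnerSeaPauliBandLimit

/-!
# Crux `FMClosureUnquenched` (stmt-QuantumFields-11512), line `von-mises-circles`, stub `stub_twoStar` —
helper 1: band limit of side-matrix determinants and adjugate entries along conjugate one-link circles

Pure algebra serving clause (a) of the two-star package (`IsFibrePoly 4` of `det (D_A ⊕ 1)` and of every
adjugate entry of `D_A ⊕ 1`, `D = wilsonDirac (fundamentalRep (Fin 3)) U m₀ 1`):

* `wilsonDirac_update_decomp3` — along `U_e ↦ X · diag(e^{iθ}, e^{-iθ}, 1) · Y` (`X, Y ∈ SU(3)` arbitrary; the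
  conjugate circles `W_e V T(θ) V⁻¹ B` are the case `X = W_e V`, `Y = V⁻¹ B`) the `r = 1` Wilson–Dirac matrix is
  `A + e^{iθ} B + e^{-iθ} C` with `rank B, rank C ≤ 4` (the LANDED `PauliBandLimit.wilsonDirac_update_decomp` is
  the case `X = U_e`, `Y = 1`; same proof: the `e^{±iθ}`-coefficients of the link are rank one in colour, the Wilson
  projectors `1 ∓ γ_μ` are rank two in spin).
* masking to a site set (`sideMask_decomp`, `rank_mask_le`) and replacing a row by a constant row
  (`updateRow_decomp`, `rank_updateRow_zero_le`) preserve the shape `A + zB + wC` and do not raise ranks; with the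
  LANDED `det_add_smul_add_smul_of_rank_le` this gives trigonometric polynomials of degree `≤ 4`
  (`trigPoly_of_laurent`, `det_trigPoly_of_rank_le`, `adjugate_trigPoly_of_rank_le`) — stated in the unfolded
  form `∃ c : ℤ → ℂ, ∀ θ, f θ = ∑_{k ∈ [-d, d]} c_k e^{ikθ}` of the skeleton's `IsTrigPoly d f`.
* `sideDet_conjCircle_trigPoly`, `sideAdjugate_conjCircle_trigPoly` — the two orbit conditions of `IsFibrePoly 4`
  for the side matrix `Matrix.of fun p q => if p.1 ∈ A ∧ q.1 ∈ A then D p q else if p = q then 1 else 0`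
  (registered vocabulary `sideMatrix A D` unfolded).

References: Montvay–Münster, *Quantum Fields on a Lattice* (CUP 1994) §4.2.2, §5.1.1 [MontvayMunster1994];
Aizenman–Schenker–Friedrich–Hundertmark, CMP 224 (2001) 219 [AizenmanEtAl2001] (side-wise depletion).
-/

open scoped BigOperators
open Matrix Complex Finset
open Literature.MathematicalPhysics.QuantumFieldTheory Literature.MathematicalPhysics.QuantumLattice
  Literature.Probability.LatticeModels
open Summit.QuantumFields.QCD.Theorems.PauliBandLimit

namespace Summit.QuantumFields.QCD.Theorems.VonMisesCirclesC1

/-! ## The one-link structure along `X · diag(z, w, 1) · Y` -/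

/-- The forward hop through the link `X · diag(z, w, 1) · Y`, split by the middle colour index: index `2` is
`θ`-free, index `0` carries `z`, index `1` carries `w`. [folklore] -/
theorem fwd_hop_decomp3 (z w Γ : ℂ) (xr yc : Fin 3 → ℂ) (P Q : Prop) [Decidable P] [Decidable Q] :
    -(1 / 2 : ℂ) * (if Q ∧ P then Γ * (∑ k : Fin 3, xr k * ![z, w, 1] k * yc k) else 0) =
      (if P then -(1 / 2 : ℂ) * xr 2 else 0) * (if Q then yc 2 else 0) * Γ +
        z * ((if P then -(1 / 2 : ℂ) * xr 0 else 0) * (if Q then yc 0 else 0) * Γ) +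
        w * ((if P then -(1 / 2 : ℂ) * xr 1 else 0) * (if Q then yc 1 else 0) * Γ) := by
  by_cases hQ : Q
  · by_cases hP : P
    · simp [hP, hQ, Fin.sum_univ_three]; ring
    · simp [hP, hQ]
  · simp [hQ]

/-- The backward hop through the link `X · diag(z, w, 1) · Y` on the unit circle (`z̄ = w`), split by the
middle colour index: index `2` is `θ`-free, index `1` carries `z`, index `0` carries `w`. [folklore] -/
theorem bwd_hop_decomp3 (z w Γ : ℂ) (hz : star z = w) (hw : star w = z) (xr yc : Fin 3 → ℂ)
    (P Q : Prop) [Decidable P] [Decidable Q] :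
    -(1 / 2 : ℂ) * (if P ∧ Q then Γ * star (∑ k : Fin 3, xr k * ![z, w, 1] k * yc k) else 0) =
      (if P then -(1 / 2 : ℂ) * star (yc 2) else 0) * (if Q then star (xr 2) else 0) * Γ +
        z * ((if P then -(1 / 2 : ℂ) * star (yc 1) else 0) * (if Q then star (xr 1) else 0) * Γ) +
        w * ((if P then -(1 / 2 : ℂ) * star (yc 0) else 0) * (if Q then star (xr 0) else 0) * Γ) := by
  have hz' : (starRingEnd ℂ) z = w := hz
  have hw' : (starRingEnd ℂ) w = z := hw
  by_cases hP : P
  · by_cases hQ : Q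
    · simp [hP, hQ, hz', hw', Fin.sum_univ_three]; ring
    · simp [hP, hQ]
  · simp [hP]

variable {L : ℕ}

/-- **The one-link structure `D(θ) = A + e^{iθ} B + e^{-iθ} C`, `rank B, rank C ≤ 4`, along
`U_e ↦ X · diag(e^{iθ}, e^{-iθ}, 1) · Y`** for arbitrary `X, Y ∈ SU(3)`: `B` (resp. `C`) is the middle-colour-`0`
(resp. `1`) slice of the forward hop `-½ (1 - γ_{μ₀}) ⊗ (X T Y)` plus the middle-colour-`1` (resp. `0`) slice of
the backward hop `-½ (1 + γ_{μ₀}) ⊗ (X T Y)†`, each (vector) ⊗ (rank-two projector). [folklore] -/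
theorem wilsonDirac_update_decomp3 [NeZero L] (U : GaugeConfig 4 L (Matrix.specialUnitaryGroup (Fin 3) ℂ))
    (m₀ : ℝ) (e : Edge 4 L) (X Y : Matrix.specialUnitaryGroup (Fin 3) ℂ)
    (T : ℝ → Matrix.specialUnitaryGroup (Fin 3) ℂ)
    (hT : ∀ θ : ℝ, (T θ : Matrix (Fin 3) (Fin 3) ℂ) =
      Matrix.diagonal ![Complex.exp (θ * Complex.I), Complex.exp (-(θ * Complex.I)), 1]) :
    ∃ A B C : Matrix (TorusSite 4 L × Fin 3 × Fin 4) (TorusSite 4 L × Fin 3 × Fin 4) ℂ,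
      B.rank ≤ 4 ∧ C.rank ≤ 4 ∧ ∀ θ : ℝ,
        wilsonDirac (fundamentalRep (Fin 3)) (Function.update U e (X * T θ * Y)) m₀ 1 =
          A + Complex.exp (θ * Complex.I) • B + Complex.exp (-(θ * Complex.I)) • C := by
  set fP : Fin 3 → Matrix (TorusSite 4 L × Fin 3 × Fin 4) (Fin 2) ℂ := fun k =>
    Matrix.of fun p δ =>
      (if p.1 = e.1 then -(1 / 2 : ℂ) * (X : Matrix (Fin 3) (Fin 3) ℂ) p.2.1 k else 0) *
        ![(1 - euclideanGamma e.2) p.2.2 0, (1 - euclideanGamma e.2) p.2.2 1] δ with hfP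
  set fQ : Fin 3 → Matrix (Fin 2) (TorusSite 4 L × Fin 3 × Fin 4) ℂ := fun k =>
    Matrix.of fun δ q =>
      ![(1 - euclideanGamma e.2) 0 q.2.2, (1 - euclideanGamma e.2) 1 q.2.2] δ *
        (if q.1 = Site.shift e.1 e.2 then (Y : Matrix (Fin 3) (Fin 3) ℂ) k q.2.1 else 0) with hfQ
  set bP : Fin 3 → Matrix (TorusSite 4 L × Fin 3 × Fin 4) (Fin 2) ℂ := fun k =>
    Matrix.of fun p δ =>
      (if p.1 = Site.shift e.1 e.2 then
          -(1 / 2 : ℂ) * star ((Y : Matrix (Fin 3) (Fin 3) ℂ) k p.2.1) else 0) *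
        ![(1 + euclideanGamma e.2) p.2.2 0, (1 + euclideanGamma e.2) p.2.2 1] δ with hbP
  set bQ : Fin 3 → Matrix (Fin 2) (TorusSite 4 L × Fin 3 × Fin 4) ℂ := fun k =>
    Matrix.of fun δ q =>
      ![(1 + euclideanGamma e.2) 0 q.2.2, (1 + euclideanGamma e.2) 1 q.2.2] δ *
        (if q.1 = e.1 then star ((X : Matrix (Fin 3) (Fin 3) ℂ) q.2.1 k) else 0) with hbQ
  -- the `θ`-independent part off the link `e`
  set W0 : Matrix (TorusSite 4 L × Fin 3 × Fin 4) (TorusSite 4 L × Fin 3 × Fin 4) ℂ :=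
    Matrix.of fun p q =>
      (if p = q then ((m₀ + 4 : ℝ) : ℂ) else 0) -
        (1 / 2 : ℂ) * ∑ μ : Fin 4,
          ((if q.1 = Site.shift p.1 μ ∧ (p.1, μ) ≠ e then
              (1 - euclideanGamma μ) p.2.2 q.2.2 *
                (U (p.1, μ) : Matrix (Fin 3) (Fin 3) ℂ) p.2.1 q.2.1
            else 0) +
           (if p.1 = Site.shift q.1 μ ∧ (q.1, μ) ≠ e then
              (1 + euclideanGamma μ) p.2.2 q.2.2 *
                star ((U (q.1, μ) : Matrix (Fin 3) (Fin 3) ℂ) q.2.1 p.2.1)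
            else 0)) with hW0
  have hmul_f : ∀ k p q, (fP k * fQ k) p q =
      (if p.1 = e.1 then -(1 / 2 : ℂ) * (X : Matrix (Fin 3) (Fin 3) ℂ) p.2.1 k else 0) *
        (if q.1 = Site.shift e.1 e.2 then (Y : Matrix (Fin 3) (Fin 3) ℂ) k q.2.1 else 0) *
          (1 - euclideanGamma e.2) p.2.2 q.2.2 := fun k p q =>
    of_mul_of_apply _ (oneSubGamma_apply_eq e.2) _ _ _ _ p q
  have hmul_b : ∀ k p q, (bP k * bQ k) p q =
      (if p.1 = Site.shift e.1 e.2 then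
          -(1 / 2 : ℂ) * star ((Y : Matrix (Fin 3) (Fin 3) ℂ) k p.2.1) else 0) *
        (if q.1 = e.1 then star ((X : Matrix (Fin 3) (Fin 3) ℂ) q.2.1 k) else 0) *
          (1 + euclideanGamma e.2) p.2.2 q.2.2 := fun k p q =>
    of_mul_of_apply _ (oneAddGamma_apply_eq e.2) _ _ _ _ p q
  refine ⟨W0 + (fP 2 * fQ 2 + bP 2 * bQ 2), fP 0 * fQ 0 + bP 1 * bQ 1, fP 1 * fQ 1 + bP 0 * bQ 0,
    (rank_add_le' _ _).trans (add_le_add (rank_mul_fin_two_le _ _) (rank_mul_fin_two_le _ _)),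
    (rank_add_le' _ _).trans (add_le_add (rank_mul_fin_two_le _ _) (rank_mul_fin_two_le _ _)),
    fun θ => ?_⟩
  have hz : star (Complex.exp (θ * Complex.I)) = Complex.exp (-(θ * Complex.I)) := by
    rw [← starRingEnd_apply, ← Complex.exp_conj, map_mul, Complex.conj_ofReal, Complex.conj_I]
    ring_nf
  have hw : star (Complex.exp (-(θ * Complex.I))) = Complex.exp (θ * Complex.I) := by
    rw [← hz, star_star]
  have hlink : ∀ a b : Fin 3,
      ((X : Matrix (Fin 3) (Fin 3) ℂ) *
          Matrix.diagonal ![Complex.exp (θ * Complex.I), Complex.exp (-(θ * Complex.I)), 1] *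
          (Y : Matrix (Fin 3) (Fin 3) ℂ)) a b =
        ∑ k : Fin 3, (X : Matrix (Fin 3) (Fin 3) ℂ) a k *
          ![Complex.exp (θ * Complex.I), Complex.exp (-(θ * Complex.I)), 1] k *
          (Y : Matrix (Fin 3) (Fin 3) ℂ) k b := by
    intro a b
    rw [Matrix.mul_apply]
    simp_rw [Matrix.mul_diagonal]
  ext p q
  obtain ⟨x, a, α⟩ := p
  obtain ⟨y, b, β⟩ := q
  rw [wilsonDirac_update_apply, Submonoid.coe_mul, Submonoid.coe_mul, hT θ, hlink, hlink]
  -- protect the two projectors from `Matrix.add_apply`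
  set Γm : Matrix (Fin 4) (Fin 4) ℂ := 1 - euclideanGamma e.2 with hΓm
  set Γp : Matrix (Fin 4) (Fin 4) ℂ := 1 + euclideanGamma e.2 with hΓp
  simp only [Matrix.add_apply, Matrix.smul_apply, smul_eq_mul, hmul_f, hmul_b, hW0, Matrix.of_apply]
  linear_combination
    fwd_hop_decomp3 (Complex.exp (θ * Complex.I)) (Complex.exp (-(θ * Complex.I))) (Γm α β)
        ((X : Matrix (Fin 3) (Fin 3) ℂ) a) (fun k => (Y : Matrix (Fin 3) (Fin 3) ℂ) k b)
        (x = e.1) (y = Site.shift e.1 e.2) +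
      bwd_hop_decomp3 (Complex.exp (θ * Complex.I)) (Complex.exp (-(θ * Complex.I))) (Γp α β) hz hw
        ((X : Matrix (Fin 3) (Fin 3) ℂ) b) (fun k => (Y : Matrix (Fin 3) (Fin 3) ℂ) k a)
        (x = Site.shift e.1 e.2) (y = e.1)

/-! ## Masks, row replacements, Laurent form -/

variable {n : Type*} [Fintype n] [DecidableEq n]

omit [Fintype n] in
/-- Masking to a set of indices (identity outside) preserves the shape `A + zB + wC`. [folklore] -/
theorem sideMask_decomp (keep : n → Prop) [DecidablePred keep] (A B C : Matrix n n ℂ) (z w : ℂ) :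
    (Matrix.of fun p q => if keep p ∧ keep q then (A + z • B + w • C) p q else if p = q then 1 else 0) =
      (Matrix.of fun p q => if keep p ∧ keep q then A p q else if p = q then 1 else 0) +
        z • (Matrix.of fun p q => if keep p ∧ keep q then B p q else 0) +
        w • (Matrix.of fun p q => if keep p ∧ keep q then C p q else 0) := by
  ext p q
  simp only [Matrix.add_apply, Matrix.smul_apply, Matrix.of_apply, smul_eq_mul]
  split_ifs <;> ring

/-- Masking (zero outside) does not raise the rank: it is `P B P` for a diagonal projector `P`. [folklore] -/
theorem rank_mask_le (keep : n → Prop) [DecidablePred keep] (B : Matrix n n ℂ) :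
    (Matrix.of fun p q => if keep p ∧ keep q then B p q else 0).rank ≤ B.rank := by
  have h : (Matrix.of fun p q => if keep p ∧ keep q then B p q else 0) =
      Matrix.diagonal (fun p => if keep p then (1 : ℂ) else 0) * B *
        Matrix.diagonal (fun q => if keep q then (1 : ℂ) else 0) := by
    ext p q
    rw [Matrix.mul_diagonal, Matrix.diagonal_mul, Matrix.of_apply]
    by_cases hp : keep p <;> by_cases hq : keep q <;> simp [hp, hq]
  rw [h]
  exact (Matrix.rank_mul_le_left _ _).trans (Matrix.rank_mul_le_right _ _)

omit [Fintype n] in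
/-- Replacing a row by a constant row preserves the shape `A + zB + wC`. [folklore] -/
theorem updateRow_decomp (A B C : Matrix n n ℂ) (z w : ℂ) (j : n) (v : n → ℂ) :
    (A + z • B + w • C).updateRow j v =
      A.updateRow j v + z • B.updateRow j 0 + w • C.updateRow j 0 := by
  ext p q
  simp only [Matrix.updateRow_apply, Matrix.add_apply, Matrix.smul_apply, smul_eq_mul,
    Pi.zero_apply]
  split_ifs <;> ring

/-- Zeroing a row does not raise the rank. [folklore] -/
theorem rank_updateRow_zero_le (B : Matrix n n ℂ) (j : n) : (B.updateRow j 0).rank ≤ B.rank := by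
  have h : B.updateRow j 0 = Matrix.diagonal (fun p => if p = j then (0 : ℂ) else 1) * B := by
    ext p q
    rw [Matrix.diagonal_mul, Matrix.updateRow_apply]
    split_ifs <;> simp
  rw [h]
  exact Matrix.rank_mul_le_right _ _

/-- A Laurent polynomial `w^d ∑_{k ≤ 2d} c_k z^k` on the unit circle (`z = e^{iθ}`, `w = e^{-iθ}`) is a
trigonometric polynomial of degree `≤ d` (reindex `k ↦ k - d`). [folklore] -/
theorem trigPoly_of_laurent (d : ℕ) (F : ℝ → ℂ) (c : ℕ → ℂ)
    (hF : ∀ θ : ℝ, F θ = Complex.exp (-(θ * Complex.I)) ^ d *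
      ∑ k ∈ Finset.range (d + d + 1), c k * Complex.exp (θ * Complex.I) ^ k) :
    ∃ c' : ℤ → ℂ, ∀ θ : ℝ,
      F θ = ∑ k ∈ Finset.Icc (-(d : ℤ)) d, c' k * Complex.exp ((k : ℂ) * (θ : ℂ) * Complex.I) := by
  refine ⟨fun k => c (k + d).toNat, fun θ => ?_⟩
  rw [hF θ, Finset.mul_sum]
  refine Finset.sum_nbij' (fun k : ℕ => (k : ℤ) - d) (fun k : ℤ => (k + d).toNat) ?_ ?_ ?_ ?_ ?_
  · intro k hk
    rw [Finset.mem_range] at hk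
    rw [Finset.mem_Icc]; omega
  · intro k hk
    rw [Finset.mem_Icc] at hk
    rw [Finset.mem_range]; omega
  · intro k hk
    simp
  · intro k hk
    rw [Finset.mem_Icc] at hk
    omega
  · intro k hk
    have h1 : ((k : ℤ) - d + d).toNat = k := by omega
    dsimp only
    rw [h1, ← Complex.exp_nat_mul, ← Complex.exp_nat_mul, mul_left_comm, ← Complex.exp_add]
    congr 1
    congr 1
    push_cast
    ring

/-- **Determinant along a two-sided rank-`d` perturbation on the circle**: if `rank B, rank C ≤ d` then
`θ ↦ det (A + e^{iθ} B + e^{-iθ} C)` is a trigonometric polynomial of degree `≤ d`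
(`det_add_smul_add_smul_of_rank_le`). [folklore] -/
theorem det_trigPoly_of_rank_le {d : ℕ} (A B C : Matrix n n ℂ) (hB : B.rank ≤ d) (hC : C.rank ≤ d) :
    ∃ c : ℤ → ℂ, ∀ θ : ℝ,
      (A + Complex.exp (θ * Complex.I) • B + Complex.exp (-(θ * Complex.I)) • C).det =
        ∑ k ∈ Finset.Icc (-(d : ℤ)) d, c k * Complex.exp ((k : ℂ) * (θ : ℂ) * Complex.I) := by
  obtain ⟨c, hc⟩ := det_add_smul_add_smul_of_rank_le A B C hB hC
  refine trigPoly_of_laurent d _ c fun θ => ?_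
  have hzw : Complex.exp (θ * Complex.I) * Complex.exp (-(θ * Complex.I)) = 1 := by
    rw [← Complex.exp_add, add_neg_cancel, Complex.exp_zero]
  exact hc _ _ hzw

/-- Every adjugate entry of `A + e^{iθ} B + e^{-iθ} C` (`rank B, rank C ≤ d`) is a trigonometric polynomial of
degree `≤ d`: `adj_{ij} = det` of the matrix with row `j` replaced by `e_i`, and zeroing a row of `B`, `C` does
not raise ranks. [folklore] -/
theorem adjugate_trigPoly_of_rank_le {d : ℕ} (A B C : Matrix n n ℂ) (hB : B.rank ≤ d)
    (hC : C.rank ≤ d) (i j : n) :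
    ∃ c : ℤ → ℂ, ∀ θ : ℝ,
      (A + Complex.exp (θ * Complex.I) • B + Complex.exp (-(θ * Complex.I)) • C).adjugate i j =
        ∑ k ∈ Finset.Icc (-(d : ℤ)) d, c k * Complex.exp ((k : ℂ) * (θ : ℂ) * Complex.I) := by
  obtain ⟨c, hc⟩ := det_trigPoly_of_rank_le (A.updateRow j (Pi.single i 1)) (B.updateRow j 0)
    (C.updateRow j 0) ((rank_updateRow_zero_le B j).trans hB) ((rank_updateRow_zero_le C j).trans hC)
  refine ⟨c, fun θ => ?_⟩
  rw [Matrix.adjugate_apply, updateRow_decomp]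
  exact hc θ

/-! ## Side matrices of the Wilson–Dirac matrix along conjugate circles -/

/-- **Orbit condition for `det (D_A ⊕ 1)`**: along every conjugate one-link circle
`θ ↦ W[e ↦ W_e · V T(θ) V⁻¹ · B]` the determinant of the side matrix of any site set `A` is a trigonometric
polynomial of degree `≤ 4`. [folklore] -/
theorem sideDet_conjCircle_trigPoly [NeZero L] (W : GaugeConfig 4 L (Matrix.specialUnitaryGroup (Fin 3) ℂ))
    (m₀ : ℝ) (e : Edge 4 L) (V B : Matrix.specialUnitaryGroup (Fin 3) ℂ)
    (T : ℝ → Matrix.specialUnitaryGroup (Fin 3) ℂ)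
    (hT : ∀ θ : ℝ, (T θ : Matrix (Fin 3) (Fin 3) ℂ) =
      Matrix.diagonal ![Complex.exp (θ * Complex.I), Complex.exp (-(θ * Complex.I)), 1])
    (A : Finset (TorusSite 4 L)) :
    ∃ c : ℤ → ℂ, ∀ θ : ℝ,
      (Matrix.of fun p q : TorusSite 4 L × Fin 3 × Fin 4 =>
          if p.1 ∈ A ∧ q.1 ∈ A then
            wilsonDirac (fundamentalRep (Fin 3))
              (Function.update W e (W e * (V * T θ * V⁻¹) * B)) m₀ 1 p q
          else if p = q then 1 else 0).det =
        ∑ k ∈ Finset.Icc (-(4 : ℤ)) 4, c k * Complex.exp ((k : ℂ) * (θ : ℂ) * Complex.I) := by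
  obtain ⟨A₀, B₀, C₀, hB, hC, hdec⟩ := wilsonDirac_update_decomp3 W m₀ e (W e * V) (V⁻¹ * B) T hT
  obtain ⟨c, hc⟩ := det_trigPoly_of_rank_le
    (Matrix.of fun p q : TorusSite 4 L × Fin 3 × Fin 4 =>
      if p.1 ∈ A ∧ q.1 ∈ A then A₀ p q else if p = q then 1 else 0)
    (Matrix.of fun p q : TorusSite 4 L × Fin 3 × Fin 4 => if p.1 ∈ A ∧ q.1 ∈ A then B₀ p q else 0)
    (Matrix.of fun p q : TorusSite 4 L × Fin 3 × Fin 4 => if p.1 ∈ A ∧ q.1 ∈ A then C₀ p q else 0)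
    ((rank_mask_le (fun p : TorusSite 4 L × Fin 3 × Fin 4 => p.1 ∈ A) B₀).trans hB)
    ((rank_mask_le (fun p : TorusSite 4 L × Fin 3 × Fin 4 => p.1 ∈ A) C₀).trans hC)
  refine ⟨c, fun θ => ?_⟩
  have hassoc : W e * (V * T θ * V⁻¹) * B = W e * V * T θ * (V⁻¹ * B) := by group
  rw [hassoc, hdec θ]
  exact (congrArg Matrix.det (sideMask_decomp
    (fun p : TorusSite 4 L × Fin 3 × Fin 4 => p.1 ∈ A) A₀ B₀ C₀ _ _)).trans (hc θ)

/-- **Orbit condition for the adjugate entries of `D_A ⊕ 1`**: along every conjugate one-link circle every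
adjugate entry of the side matrix of any site set `A` is a trigonometric polynomial of degree `≤ 4`. [folklore] -/
theorem sideAdjugate_conjCircle_trigPoly [NeZero L]
    (W : GaugeConfig 4 L (Matrix.specialUnitaryGroup (Fin 3) ℂ))
    (m₀ : ℝ) (e : Edge 4 L) (V B : Matrix.specialUnitaryGroup (Fin 3) ℂ)
    (T : ℝ → Matrix.specialUnitaryGroup (Fin 3) ℂ)
    (hT : ∀ θ : ℝ, (T θ : Matrix (Fin 3) (Fin 3) ℂ) =
      Matrix.diagonal ![Complex.exp (θ * Complex.I), Complex.exp (-(θ * Complex.I)), 1])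
    (A : Finset (TorusSite 4 L)) (i j : TorusSite 4 L × Fin 3 × Fin 4) :
    ∃ c : ℤ → ℂ, ∀ θ : ℝ,
      (Matrix.of fun p q : TorusSite 4 L × Fin 3 × Fin 4 =>
          if p.1 ∈ A ∧ q.1 ∈ A then
            wilsonDirac (fundamentalRep (Fin 3))
              (Function.update W e (W e * (V * T θ * V⁻¹) * B)) m₀ 1 p q
          else if p = q then 1 else 0).adjugate i j =
        ∑ k ∈ Finset.Icc (-(4 : ℤ)) 4, c k * Complex.exp ((k : ℂ) * (θ : ℂ) * Complex.I) := by
  obtain ⟨A₀, B₀, C₀, hB, hC, hdec⟩ := wilsonDirac_update_decomp3 W m₀ e (W e * V) (V⁻¹ * B) T hT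
  obtain ⟨c, hc⟩ := adjugate_trigPoly_of_rank_le
    (Matrix.of fun p q : TorusSite 4 L × Fin 3 × Fin 4 =>
      if p.1 ∈ A ∧ q.1 ∈ A then A₀ p q else if p = q then 1 else 0)
    (Matrix.of fun p q : TorusSite 4 L × Fin 3 × Fin 4 => if p.1 ∈ A ∧ q.1 ∈ A then B₀ p q else 0)
    (Matrix.of fun p q : TorusSite 4 L × Fin 3 × Fin 4 => if p.1 ∈ A ∧ q.1 ∈ A then C₀ p q else 0)
    ((rank_mask_le (fun p : TorusSite 4 L × Fin 3 × Fin 4 => p.1 ∈ A) B₀).trans hB)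
    ((rank_mask_le (fun p : TorusSite 4 L × Fin 3 × Fin 4 => p.1 ∈ A) C₀).trans hC) i j
  refine ⟨c, fun θ => ?_⟩
  have hassoc : W e * (V * T θ * V⁻¹) * B = W e * V * T θ * (V⁻¹ * B) := by group
  rw [hassoc, hdec θ]
  exact (congrArg (fun M => Matrix.adjugate M i j) (sideMask_decomp
    (fun p : TorusSite 4 L × Fin 3 × Fin 4 => p.1 ∈ A) A₀ B₀ C₀ _ _)).trans (hc θ)

/-- **Registered helper `stub_twoStar_aux1` of crux stmt-QuantumFields-11512** (line `von-mises-circles`, stub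
`stub_twoStar`, clause (a)): along every conjugate one-link circle `θ ↦ W[e ↦ W_e · V T(θ) V⁻¹ · B]`,
`T(θ) = diag(e^{iθ}, e^{-iθ}, 1)`, the determinant and every adjugate entry of the side matrix `D_A ⊕ 1` of the
`r = 1` Wilson–Dirac matrix are trigonometric polynomials of degree `≤ 4` — the orbit conditions of
`IsFibrePoly 4` (registered vocabulary `sideMatrix`, `wilsonD`, `IsTrigPoly` unfolded). [folklore] -/
theorem stub_twoStar_aux1 : ∀ (T : ℝ → Matrix.specialUnitaryGroup (Fin 3) ℂ), (∀ θ : ℝ, ((T θ : Matrix.specialUnitaryGroup (Fin 3) ℂ) : Matrix (Fin 3) (Fin 3) ℂ) = Matrix.diagonal ![Complex.exp (θ * Complex.I), Complex.exp (-(θ * Complex.I)), 1]) → ∀ (N : ℕ) [NeZero N] (W : GaugeConfig 4 N (Matrix.specialUnitaryGroup (Fin 3) ℂ)) (m₀ : ℝ) (e : Edge 4 N) (V B : Matrix.specialUnitaryGroup (Fin 3) ℂ) (A : Finset (TorusSite 4 N)), (∃ c : ℤ → ℂ, ∀ θ : ℝ, (Matrix.of fun p q : TorusSite 4 N × Fin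 3 × Fin 4 => if p.1 ∈ A ∧ q.1 ∈ A then wilsonDirac (fundamentalRep (Fin 3)) (Function.update W e (W e * (V * T θ * V⁻¹) * B)) m₀ 1 p q else if p = q then 1 else 0).det = ∑ k ∈ Finset.Icc (-(4 : ℤ)) 4, c k * Complex.exp ((k : ℂ) * (θ : ℂ) * Complex.I)) ∧ ∀ i j : TorusSite 4 N × Fin 3 × Fin 4, ∃ c : ℤ → ℂ, ∀ θ : ℝ, (Matrix.of fun p q : TorusSite 4 N × Fin 3 × Fin 4 => if p.1 ∈ A ∧ q.1 ∈ A then wilsonDirac (fundamentalRep (Fin 3)) (Function.update W e (W e * (V * T θ * V⁻¹) * B)) m₀ 1 p q else if p = q then 1 else 0).adjugate i j = ∑ k ∈ Finset.Icc (-(4 : ℤ)) 4, c k * Complex.exp ((k : ℂ) * (θ : ℂ) * Complex.I) := by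
  intro T hT N _ W m₀ e V B A
  exact ⟨sideDet_conjCircle_trigPoly W m₀ e V B T hT A,
    fun i j => sideAdjugate_conjCircle_trigPoly W m₀ e V B T hT A i j⟩

end Summit.QuantumFields.QCD.Theorems.VonMisesCirclesC1
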